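import Summits.ResolutionOfSingularities.ResolutionOfSingularities.Theses.UniformComplexity

/-! S → C by hand (the refuter's `Evidence.summit_implies_crux`, re-derived): the summit gives the conclusion of
`PrimeModelTransfer` directly, ignoring its hypothesis — PMT is a CONSEQUENCE of S. -/

open AlgebraicGeometry
open Summit.ResolutionOfSingularities.ResolutionOfSingularities.Theses.UniformComplexity

theorem summit_implies_primeModelTransfer (h : _root_.ResolutionOfSingularities) : PrimeModelTransfer := by
  intro p hp _ K _ _ _ X f hs hl hq hX
  haveI : IsReduced X := inferInstance
  exact h p hp K X f hs hl hq inferInstance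

#print axioms summit_implies_primeModelTransfer
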